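import Summits.ResolutionOfSingularities.ResolutionOfSingularities.Theorems.FrobeniusLadderFInjectiveMacaulayficationOmegaOneGlobalCureFanTables1
import Summits.ResolutionOfSingularities.ResolutionOfSingularities.Theorems.FrobeniusLadderFInjectiveMacaulayficationOmegaOneGlobalCureFanTables2
import Summits.ResolutionOfSingularities.ResolutionOfSingularities.Theorems.FrobeniusLadderFInjectiveMacaulayficationOmegaOneGlobalCureFanTables3
import Summits.ResolutionOfSingularities.ResolutionOfSingularities.Theorems.FrobeniusLadderFInjectiveMacaulayficationOmegaOneGlobalCureFanTables4
import Summits.ResolutionOfSingularities.ResolutionOfSingularities.Theorems.FrobeniusLadderFInjectiveMacaulayficationOmegaOneGlobalCureFanTables5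
import HarnessLib

/-!
# BED Ω, GLOBAL PATCH (g-b), F5 KERNEL CERTIFICATE: the global cure fan Σ₂ is REGULAR, REFINES Σ(B9), is a COMPLETE fan over the orthant with a STRICTLY CONVEX integer support
# function (h = 0 on the unit rays), and EVERY (cone, torus orbit meeting the strict transform) carries an exit tag of ✓ `OmegaOneCureFanCertStrong.exitOKW'`
# (crux `FInjectiveMacaulayfication` stmt-ResolutionOfSingularities-15315, chain w45a; kit j329694, report `g14/F5-GLOBAL-FAN-REPORT.md`; seat res-L1-w45a-stub-3 g14)

[OURS · L1 W4.5a] Support file (`--supports stmt-ResolutionOfSingularities-15315 --as helper`); Boolean list programs over the tables of `…OmegaOneGlobalCureFanTables1–5` and `decide +kernel`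
certificates; COMBINATORICS ONLY — the toric / blow-up SEMANTICS (Σ₂ regular projective ⇒ `X_{Σ₂} = Bl_{K′}𝔸⁵`; exit tag ⇒ FULL of the pencil rings) is NOT asserted here (F6). NOT a statement of
any manuscript; nothing of the crux is proved. AI-written (AI review is weaker than expert review).
* §1 checkers: `checkSubcones` (every cone of Σ₂ lies in its parent cone of Σ(B9): ℕ-coefficient certificate), `checkFacetsNbr` (every facet has a registered neighbouring cone or lies in
  a coordinate hyperplane), `checkSupport` (vertices `m_σ = V_σ⁻¹ h_σ ≥ 0` and `⟨ρ_j, m_σ⟩ ≥ h_j + 1` for every ray `j ∉ σ`), `orbitRelevant` (the orbit `O_Z` meets `V(θ_σ)`: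
  `θ_σ|_{y_Z = 0} ≠ 1`), `checkExitsRel` (weighted exit check of ✓ `exitOKW'` with `C = ⟨ρ, m_L(parent)⟩`, tag `9` exactly on the irrelevant orbits).
* §2 ★ certificates: `cert_S2_sizes`, ★ `cert_S2_det` (all 1223 cones unimodular, ✓ `FanCheckKit.checkDetUnit`), ★ `cert_S2_subcones`, ★ `cert_S2_facets`, ★ `cert_S2_support`,
  ★★ `cert_S2_exits`, `census_S2` (tags 0:5884 · 1:15251 · 2:158 · 3:32 · 4:15 · 5:630 · 9 (irrelevant):15943).
[cite: CoxLittleSchenck2011, Thm. 3.1.19, Prop. 6.1.10 and §7.1 (support functions, projectivity), §11.1]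
-/

set_option linter.dupNamespace false
set_option linter.style.longLine false

namespace Summit.ResolutionOfSingularities.ResolutionOfSingularities.Theorems.FInjectiveMacaulayfication.OmegaOneGlobalCureFanCert

open Summit.ResolutionOfSingularities.ResolutionOfSingularities.Theorems.FInjectiveMacaulayfication
open FanCheckKit OmegaOneCureFanCert OmegaOneCureFanCertStrong

/-! ## §1 The Boolean checkers -/

/-- For each cone, the COLUMNS of the integer inverse of its ray matrix (`⟨ray_a, col_i⟩ = δ_ai`), in the format of ✓ `FanCheckKit.checkDetUnit`, assembled as `VINVP − VINVN`
(ℕ tables elaborate fast; ℤ literals do not). [data] -/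
def VINV_S2 : List (List (List ℤ)) := (VINVP_S2.zip VINVN_S2).map fun pn => (pn.1.zip pn.2).map fun cd => (cd.1.zip cd.2).map fun xy => (xy.1 : ℤ) - (xy.2 : ℤ)


/-- Cone list in the record format of ✓ `FanCheckKit.checkDetUnit`. [plumbing] -/
def CL_S2 : List (List ℕ × (ℕ × ℕ) × List (ℕ × ℕ) × List (List ℕ)) := CONES_S2.map fun c => (c, (0, 0), ([] : List (ℕ × ℕ)), ([] : List (List ℕ)))

/-- `Σ_j coef_j · (parent ray j)`. [plumbing] -/
def combRays (n : ℕ) (prow : List (List ℕ)) (coef : List ℕ) : List ℕ :=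
  (List.range n).map fun k => ((coef.zip prow).map fun cp => cp.1 * getL cp.2 k 0).sum

/-- ★ Every cone of Σ₂ lies in its parent cone of Σ(B9): each of its rays is the certified ℕ-combination of the parent's rays. [OURS · bookkeeping] -/
def checkSubcones (n : ℕ) (RAYS CONES CONESP : List (List ℕ)) (PARENT : List ℕ) (COEF : List (List (List ℕ))) : Bool :=
  Nat.beq CONES.length PARENT.length && Nat.beq CONES.length COEF.length &&
  (CONES.zip (PARENT.zip COEF)).all fun cpc =>
    let prow := raysOf RAYS (getL CONESP cpc.2.1 [])
    Nat.beq cpc.1.length cpc.2.2.length && (cpc.1.zip cpc.2.2).all fun jc => (getL RAYS jc.1 []) == combRays n prow jc.2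

/-- ★ Facet pairing by a neighbour table: facet `k` of cone `a` lies on the registered cone `NBR[a][k] ≠ a`, or (`NBR[a][k] = #cones`) in a coordinate hyperplane. [OURS · bookkeeping] -/
def checkFacetsNbr (n : ℕ) (RAYS CONES NBR : List (List ℕ)) : Bool :=
  Nat.beq CONES.length NBR.length && ((List.range CONES.length).zip (CONES.zip NBR)).all fun acn =>
    Nat.beq acn.2.1.length n && Nat.beq acn.2.2.length n && (List.range n).all fun k =>
      let f := acn.2.1.eraseIdx k
      let b := getL acn.2.2 k 0
      if Nat.blt b CONES.length then !(Nat.beq b acn.1) && f.all fun i => (getL CONES b []).any fun j => Nat.beq i j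
      else (List.range n).any fun i => f.all fun j => Nat.beq (getL (getL RAYS j []) i 0) 0

/-- The vertex `m_σ = Σ_i h_{σ_i} · col_i` (`col_i` the columns of `V_σ⁻¹`). [plumbing] -/
def vertexOf (n : ℕ) (H : List ℕ) (c : List ℕ) (cols : List (List ℤ)) : List ℤ :=
  (List.range n).map fun r => ((c.zip cols).map fun jc => (getL H jc.1 0 : ℤ) * getL jc.2 r 0).sum

/-- ★ Strict convexity of the support function: `m_σ ≥ 0` and `⟨ρ_j, m_σ⟩ ≥ h_j + 1` for every ray `j ∉ σ`. [OURS · bookkeeping; cite: CoxLittleSchenck2011, §6.1] -/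
def checkSupport (n : ℕ) (RAYS CONES : List (List ℕ)) (VINV : List (List (List ℤ))) (H : List ℕ) : Bool :=
  Nat.beq CONES.length VINV.length && (CONES.zip VINV).all fun cv =>
    let m := vertexOf n H cv.1 cv.2
    (m.all fun x => decide (0 ≤ x)) &&
    ((List.range RAYS.length).zip RAYS).all fun jr => (cv.1.any fun i => Nat.beq i jr.1) || decide ((getL H jr.1 0 : ℤ) + 1 ≤ dotZL jr.2 m)

/-- Minimum of a list (`0` on `[]`). [plumbing] -/
def lmin : List ℕ → ℕ
  | [] => 0
  | [a] => a
  | a :: as => min a (lmin as)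

/-- The exponents of the strict transform `θ_σ` of `f` on the chart of the cone with ray rows `rows`: `⟨ρ_i, e⟩ − min`. [plumbing] -/
def thetaExps (n : ℕ) (FEXPS : List (List ℕ)) (rows : List (List ℕ)) : List (List ℕ) :=
  let fi := FEXPS.map fun e => rows.map fun ρ => dotL ρ e
  let d := (List.range n).map fun i => lmin (fi.map fun v => getL v i 0)
  fi.map fun v => vsub v d

/-- The orbit `O_Z` (letters in `Z` vanish, the others are units) MEETS `V(θ_σ)`: `θ_σ|_{y_Z = 0}` is not the single monomial `1`. [OURS · bookkeeping] -/
def orbitRelevant (n : ℕ) (FEXPS : List (List ℕ)) (rows : List (List ℕ)) (Z : List ℕ) : Bool :=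
  let surv := (thetaExps n FEXPS rows).filter fun v => (onZ Z v).all fun x => Nat.beq x 0
  !(Nat.beq surv.length 1 && (getL surv 0 []).all fun x => Nat.beq x 0)

/-- ★★ All (cone, orbit) pairs: the weighted strengthened exit check ✓ `exitOKW'` with `C = ⟨ρ, m_L(parent)⟩` on the relevant orbits, tag `9` exactly on the irrelevant ones. [OURS · bookkeeping] -/
def checkExitsRel (n : ℕ) (P Q : List ℕ) (FEXPS RAYS CONES CWS : List (List ℕ)) (PARENT : List ℕ) (ORB TAGS : List (List ℕ)) : Bool :=
  Nat.beq CONES.length TAGS.length && Nat.beq CONES.length PARENT.length &&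
  (CONES.zip (PARENT.zip TAGS)).all fun cpt =>
    let rows := raysOf RAYS cpt.1
    let CW := getL CWS cpt.2.1 []
    Nat.beq ORB.length cpt.2.2.length && (ORB.zip cpt.2.2).all fun zt =>
      if orbitRelevant n FEXPS rows zt.1 then exitOKW' n CW P Q rows zt.1 zt.2 else Nat.beq zt.2 9

/-! ## §2 ★ The certificates (`decide +kernel`) -/

/-- Sizes: 139 rays, 1223 cones of 5 rays each, 31 orbits per cone, `h = 0` on the five unit rays. [certificate] -/
theorem cert_S2_sizes : RAYS_S2.length = 139 ∧ CONES_S2.length = 1223 ∧ allLen 5 RAYS_S2 = true ∧ allLen 5 CONES_S2 = true ∧ ORB5.length = 31 ∧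
    (RAYS_S2.take 5 = [[0, 0, 0, 0, 1], [0, 0, 0, 1, 0], [0, 0, 1, 0, 0], [0, 1, 0, 0, 0], [1, 0, 0, 0, 0]]) ∧ H_S2.take 5 = [0, 0, 0, 0, 0] ∧ H_S2.length = 139 := by
  decide +kernel

/-- ★ Every cone of Σ₂ is unimodular (explicit integer inverse). [certificate] -/
theorem cert_S2_det : checkDetUnit 5 RAYS_S2 CL_S2 VINV_S2 = true := by
  decide +kernel

/-- ★ Every cone of Σ₂ lies in its parent cone of Σ(B9) (`CONES_B9IDX`, numbering 0–24). [certificate] -/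
theorem cert_S2_subcones : checkSubcones 5 RAYS_S2 CONES_S2 CONES_B9IDX PARENT_S2 COEF_S2 = true := by
  decide +kernel

/-- ★ Facet pairing (completeness over the orthant, given §`cert_S2_support`). [certificate] -/
theorem cert_S2_facets : checkFacetsNbr 5 RAYS_S2 CONES_S2 NBR_S2 = true := by
  decide +kernel

/-- ★ The support function `H_S2` is strictly convex on Σ₂ with non-negative vertices (⇒ Σ₂ is the normal fan of `{m : ⟨ρ_j, m⟩ ≥ h_j}`, `X_{Σ₂} = Bl_{K′} 𝔸⁵` projective, `V(K′) = {0}`).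
[certificate; cite: CoxLittleSchenck2011, Prop. 6.1.10, Thm. 7.1.10] -/
theorem cert_S2_support : checkSupport 5 RAYS_S2 CONES_S2 VINV_S2 H_S2 = true := by
  decide +kernel

/-- ★★ Every (cone, orbit meeting `V(θ_σ)`) passes ✓ `exitOKW'` with its recorded tag (`P = x u²`, `Q = y³`, `C = ⟨ρ, m_L(parent)⟩`); irrelevant orbits are tagged `9`. [certificate] -/
theorem cert_S2_exits : checkExitsRel 5 [1, 0, 2, 0, 0] [0, 3, 0, 0, 0] FEXPS_B9 RAYS_S2 CONES_S2 CWS_S2 PARENT_S2 ORB5 TAGS_S2 = true := by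
  decide +kernel

/-- Tag census. [certificate] -/
theorem census_S2 : ((List.range 10).map fun t => TAGS_S2.flatten.count t) = [5884, 15251, 158, 32, 15, 630, 0, 0, 0, 15943] := by
  decide +kernel

end Summit.ResolutionOfSingularities.ResolutionOfSingularities.Theorems.FInjectiveMacaulayfication.OmegaOneGlobalCureFanCert
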